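import Summits.HubbardSuperconductivity.HubbardSuperconductivity.Theorems.LevyLogBootstrapDressHalfFilledKernelStructure
import Literature.MathematicalPhysics.QuantumLattice.InfiniteVolumeSpinEntriesProofs
import HarnessLib

/-!
# Crux `DressHalfFilled` (stmt-HubbardSuperconductivity-8148, route `LevyLogBootstrap`; shared with route
# `AnisotropyChord` and, for stubs 1–2, with crux stmt-10291 `DressAnyFilling`): KATO'S TWO-PLAQUETTE KERNEL IS ONE
# BOND OF `2J · XXZ(Δ_eff)` — the per-bond form of dictionary clause (d), conventions pinned

Support file (`--supports stmt-HubbardSuperconductivity-8148`) for stub 2 (`stub_plaquetteDictionary`), clause (d):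
`⟨Φφ', T S(E₀) T Φφ⟩ = -⟨φ', (2J(U) · xxzHamiltonian 1 (torusGraph 2 M) (-1) Δ_eff(U) + k(N_b)) φ⟩`. Since
`interClusterKernel = ⟨κ'| V (E - H₀)⁻¹_red V |κ⟩ = -⟨κ'| T S T |κ⟩` bond by bond, clause (d) says that on every
superlattice bond `{R, R'}` the `4 × 4` kernel `K = plaquetteKernel U` equals the matrix of the XXZ bond term
`2J · (-(Sˣ_R Sˣ_{R'} + Sʸ_R Sʸ_{R'} + Δ_eff Sᶻ_R Sᶻ_{R'}))` (`xxzHamiltonian 1 G (-1) Δ = (-1) • Σ_bonds (…)`)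
plus a diagonal part affine in `n_R + n_{R'}` (which sums to `k(N_b)` over the torus), under the dictionary
"up spin at `R` (`σ_R = 0`, `m = +½`) = one hole pair on plaquette `R` (`κ_R = 1`)", i.e. `κ_R = (σ_R).rev`.

THIS FILE PROVES exactly this per-bond identity, in the tree's spin vocabulary (`spinBond 1 α x y`, `spinX/Y/Z 1`,
`TensorIndex Λ 2`), for `U ∈ [2, 4]`:

* `plaquetteKernel_rev_eq_spinHalf` (local `2 × 2 ⊗ 2 × 2` form): for all `a b c d : Fin 2`,
  `2J (Sˣ_{ac} Sˣ_{bd} + Sʸ_{ac} Sʸ_{bd}) - V Sᶻ_{ac} Sᶻ_{bd} = -K((ā,b̄),(c̄,d̄)) + [a = c ∧ b = d] · A(ā + b̄)` with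
  `ā = a.rev` and the affine diagonal `A(s) = (Re K(0,0) - V/4) + (μ + V/2) s` — from the table `plaquetteKernel_apply`
  (`…KernelStructure`), `δE(n,n') = δE(0,0) + μ(n + n') + V n n'` (`plaquetteKernel_diag_decomposition` with `μ' = μ`,
  `…KernelSymmetry`), `Sˣ⊗Sˣ + Sʸ⊗Sʸ = ½(S⁺⊗S⁻ + S⁻⊗S⁺)` (`spinX_mul_spinX_add_spinY_mul_spinY`) and the spin-½ entries
  (`spinZ_one_apply`);
* `spinBond_xxz_apply_eq_plaquetteKernel` (ANY lattice `Λ`, any two sites `x ≠ y`, configurations `σ, τ` agreeing off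
  `{x, y}`): `⟨σ| 2J (spinBond 1 0 x y + spinBond 1 1 x y) - V spinBond 1 2 x y |τ⟩ =
  -K(((σ x).rev,(σ y).rev),((τ x).rev,(τ y).rev)) + [σ = τ] · A((σ x).rev + (σ y).rev)` — the form a stub-2 prover sums
  over the bonds of `torusGraph 2 M` (off `{x,y}`-disagreeing `σ, τ` give `0` on the spin side, `spinBond_apply_of_ne`);
* `spinBond_xxzΔ_apply_eq_plaquetteKernel` (the literal `Δ_eff` form, needs `J ≠ 0`, part of (W1)):
  `⟨σ| 2J (spinBond 1 0 x y + spinBond 1 1 x y + Δ_eff • spinBond 1 2 x y) |τ⟩ = (same right-hand side)`, the summand of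
  `xxzHamiltonian 1 G (-1) Δ_eff` being `-(spinBond 0 + spinBond 1 + Δ_eff • spinBond 2)`.

So the sign of `J` (`K((1,0),(0,1)) = -J`, real), the factor `2` (`2J · ½(S⁺S⁻ + h.c.)`), the sign convention
`Δ_eff = -V/(2J)` with ferro-planar `J_xxz = -1`, and the absence of any other entry are all CHECKED against the tree's
`xxzHamiltonian`, bond by bond.

Registered sub-goal stub (signature verbatim at the end): `dressHalfFilled_kernelXXZBond`.

Sources: H. Yao, W.-F. Tsai, S. A. Kivelson, PRB 76 (2007) 161104(R), eq. (2) and p. 4 [YaoTsaiKivelson2007];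
W.-F. Tsai, S. A. Kivelson, PRB 73 (2006) 214510, App. A [TsaiKivelson2006]; H. Tasaki, *Physics and Mathematics of
Quantum Many-Body Systems* (2020), §2.1 (2.1.5)–(2.1.6), §2.4 (2.4.1) [Tasaki2020]. No definition and no named fact.
-/

noncomputable section

set_option linter.dupNamespace false

namespace Summit.HubbardSuperconductivity.HubbardSuperconductivity.Theorems.LevyLogBootstrap

open Matrix Finset Complex Literature.MathematicalPhysics.QuantumLattice Literature.Probability.LatticeModels
open scoped ComplexOrder

section XXZBond

variable {U : ℝ}

/-! ### Spin-½ entries -/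

/-- `Sᶻ` of spin `½`: `⟨k| Sᶻ |l⟩ = δ_{kl} (½ - k)`. Tasaki (2020) (2.1.5). [cite: Tasaki2020, §2.1 eq. (2.1.5)] -/
theorem spinZ_one_apply (k l : Fin 2) :
    SpinOperators.spinZ 1 k l = if k = l then (1 / 2 : ℂ) - ((k : ℕ) : ℂ) else 0 := by
  rw [spinZ_apply]
  fin_cases k <;> fin_cases l <;> norm_num

/-! ### The local identity -/

/-- **Kato's two-plaquette kernel is one XXZ bond (local form)**, `U ∈ [2, 4]`: for all `a b c d : Fin 2`,
`2J (Sˣ_{ac} Sˣ_{bd} + Sʸ_{ac} Sʸ_{bd}) - V Sᶻ_{ac} Sᶻ_{bd} = -K((ā,b̄),(c̄,d̄)) + [a = c ∧ b = d] · ((Re K(0,0) - V/4) +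
(μ + V/2)(ā + b̄))`, `ā = a.rev` (up spin `0 ↦` one hole pair `1`). The exchange entries give `2J · ½ = J = -K((1,0),(0,1))`,
the diagonal `-V(½ - a)(½ - b) = -(δE(0,0) + μ(ā+b̄) + V ā b̄) + affine`, everything else is `0` on both sides.
[cite: YaoTsaiKivelson2007, eq. (2)] -/
theorem plaquetteKernel_rev_eq_spinHalf (hU : U ∈ Set.Icc (2 : ℝ) 4) (a b c d : Fin 2) :
    (((2 * (plaquettePairCouplings U).J : ℝ) : ℂ)) * (spinX 1 a c * spinX 1 b d + spinY 1 a c * spinY 1 b d) -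
        (((plaquettePairCouplings U).V : ℝ) : ℂ) * (SpinOperators.spinZ 1 a c * SpinOperators.spinZ 1 b d) =
      -(plaquetteKernel U (a.rev, b.rev) (c.rev, d.rev)) +
        (if a = c ∧ b = d then
          ((((plaquetteKernel U (0, 0) (0, 0)).re - (plaquettePairCouplings U).V / 4 +
              ((plaquettePairCouplings U).μ + (plaquettePairCouplings U).V / 2) *
                (((a.rev : ℕ) : ℝ) + ((b.rev : ℕ) : ℝ)) : ℝ) : ℂ))
        else 0) := by
  -- the diagonal shifts as polynomials in `δE(0,0)`, `μ`, `V` (with `μ' = μ` on `[2,4]`)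
  have hdiag : ∀ n n' : Fin 2, (plaquetteKernel U (n, n') (n, n')).re =
      (plaquetteKernel U (0, 0) (0, 0)).re + (plaquettePairCouplings U).μ * (n : ℕ) +
        (plaquettePairCouplings U).μ * (n' : ℕ) + (plaquettePairCouplings U).V * ((n : ℕ) * (n' : ℕ)) := by
    intro n n'
    rw [plaquetteKernel_diag_decomposition U n n', ← plaquettePairCouplings_mu_symm hU]
  have hd10 : (plaquetteKernel U (1, 0) (1, 0)).re =
      (plaquetteKernel U (0, 0) (0, 0)).re + (plaquettePairCouplings U).μ := by
    rw [hdiag 1 0]; simp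
  have hd01 : (plaquetteKernel U (0, 1) (0, 1)).re =
      (plaquetteKernel U (0, 0) (0, 0)).re + (plaquettePairCouplings U).μ := by
    rw [hdiag 0 1]; simp
  have hd11 : (plaquetteKernel U (1, 1) (1, 1)).re =
      (plaquetteKernel U (0, 0) (0, 0)).re + 2 * (plaquettePairCouplings U).μ + (plaquettePairCouplings U).V := by
    rw [hdiag 1 1]; simp; ring
  -- spin-½ ladder entries (`S⁺ = |0⟩⟨1|`, `S⁻ = |1⟩⟨0|`; the same two lemmas exist in the BEC summit's
  -- `LatticeCoherence` files, which are not imported here)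
  have spinRaise_one_apply : ∀ k l : Fin 2, spinRaise 1 k l = if k = 0 ∧ l = 1 then 1 else 0 := by
    intro k l
    rw [spinRaise_apply]
    fin_cases k <;> fin_cases l <;> norm_num
  have spinLower_one_apply : ∀ k l : Fin 2, spinLower 1 k l = if k = 1 ∧ l = 0 then 1 else 0 := by
    intro k l
    rw [spinLower, conjTranspose_apply, spinRaise_one_apply]
    by_cases h : k = 1 ∧ l = 0
    · rw [if_pos ⟨h.2, h.1⟩, if_pos h, star_one]
    · rw [if_neg (fun h' => h ⟨h'.2, h'.1⟩), if_neg h, star_zero]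
  have r0 : (0 : Fin 2).rev = 1 := rfl
  have r1 : (1 : Fin 2).rev = 0 := rfl
  rw [spinX_mul_spinX_add_spinY_mul_spinY, plaquetteKernel_apply hU]
  fin_cases a <;> fin_cases b <;> fin_cases c <;> fin_cases d <;>
    simp only [spinRaise_one_apply, spinLower_one_apply, spinZ_one_apply, Fin.isValue, r0, r1, Fin.zero_eta,
      Fin.mk_one, hd10, hd01, hd11, Prod.mk.injEq, Prod.swap_prod_mk, Fin.val_zero, Fin.val_one] <;>
    norm_num <;> ring

/-! ### The bond identity on an arbitrary lattice -/

/-- **Kato's two-plaquette kernel is one XXZ bond**, lattice form, `U ∈ [2, 4]`: on any finite lattice `Λ`, for two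
sites `x ≠ y` and product configurations `σ, τ : Λ → Fin 2` agreeing off `{x, y}`,
`⟨σ| 2J (spinBond 1 0 x y + spinBond 1 1 x y) - V · spinBond 1 2 x y |τ⟩ =
-K(((σ x).rev, (σ y).rev), ((τ x).rev, (τ y).rev)) + [σ = τ] · ((Re K(0,0) - V/4) + (μ + V/2)((σ x).rev + (σ y).rev))`
(up spin `=` hole pair). For `σ, τ` disagreeing off `{x, y}` the left-hand side is `0` (`spinBond_apply_of_ne`).
[cite: YaoTsaiKivelson2007, eq. (2)] -/
theorem spinBond_xxz_apply_eq_plaquetteKernel (hU : U ∈ Set.Icc (2 : ℝ) 4) {Λ : Type*} [Fintype Λ] [DecidableEq Λ]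
    {x y : Λ} (hxy : x ≠ y) (σ τ : TensorIndex Λ 2) (h : ∀ z, z ≠ x → z ≠ y → σ z = τ z) :
    ((((2 * (plaquettePairCouplings U).J : ℝ) : ℂ)) • (spinBond 1 0 x y + spinBond 1 1 x y) -
        (((plaquettePairCouplings U).V : ℝ) : ℂ) • spinBond 1 2 x y) σ τ =
      -(plaquetteKernel U ((σ x).rev, (σ y).rev) ((τ x).rev, (τ y).rev)) +
        (if σ = τ then
          ((((plaquetteKernel U (0, 0) (0, 0)).re - (plaquettePairCouplings U).V / 4 +
              ((plaquettePairCouplings U).μ + (plaquettePairCouplings U).V / 2) *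
                ((((σ x).rev : ℕ) : ℝ) + (((σ y).rev : ℕ) : ℝ)) : ℝ) : ℂ))
        else 0) := by
  have hστ : σ = τ ↔ σ x = τ x ∧ σ y = τ y := by
    constructor
    · rintro rfl; exact ⟨rfl, rfl⟩
    · rintro ⟨hx, hy⟩
      funext z
      by_cases hzx : z = x
      · rw [hzx, hx]
      · by_cases hzy : z = y
        · rw [hzy, hy]
        · exact h z hzx hzy
  rw [if_congr hστ rfl rfl, ← plaquetteKernel_rev_eq_spinHalf hU (σ x) (σ y) (τ x) (τ y)]
  simp only [Matrix.sub_apply, Matrix.smul_apply, Matrix.add_apply, smul_eq_mul, spinBond_apply_of_ne 1 _ hxy,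
    if_pos h, spinVec_zero, spinVec_one, spinVec_two]

/-- **The literal `Δ_eff` form** (`J ≠ 0`, which is part of (W1)), `U ∈ [2, 4]`: with `Δ_eff = -V/(2J)`,
`⟨σ| 2J (spinBond 1 0 x y + spinBond 1 1 x y + Δ_eff • spinBond 1 2 x y) |τ⟩` has the same value — and
`spinBond 1 0 x y + spinBond 1 1 x y + Δ • spinBond 1 2 x y` is exactly the summand of `xxzHamiltonian 1 G (-1) Δ`
(whose overall factor `J_xxz = -1` carries the minus sign of `K = -T S T`). [cite: YaoTsaiKivelson2007, eq. (2) and p. 4] -/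
theorem spinBond_xxzΔ_apply_eq_plaquetteKernel (hU : U ∈ Set.Icc (2 : ℝ) 4) (hJ : (plaquettePairCouplings U).J ≠ 0)
    {Λ : Type*} [Fintype Λ] [DecidableEq Λ] {x y : Λ} (hxy : x ≠ y) (σ τ : TensorIndex Λ 2)
    (h : ∀ z, z ≠ x → z ≠ y → σ z = τ z) :
    ((((2 * (plaquettePairCouplings U).J : ℝ) : ℂ)) •
        (spinBond 1 0 x y + spinBond 1 1 x y + (((plaquettePairCouplings U).ΔEff : ℝ) : ℂ) • spinBond 1 2 x y)) σ τ =
      -(plaquetteKernel U ((σ x).rev, (σ y).rev) ((τ x).rev, (τ y).rev)) +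
        (if σ = τ then
          ((((plaquetteKernel U (0, 0) (0, 0)).re - (plaquettePairCouplings U).V / 4 +
              ((plaquettePairCouplings U).μ + (plaquettePairCouplings U).V / 2) *
                ((((σ x).rev : ℕ) : ℝ) + (((σ y).rev : ℕ) : ℝ)) : ℝ) : ℂ))
        else 0) := by
  rw [← spinBond_xxz_apply_eq_plaquetteKernel hU hxy σ τ h]
  -- `2J · (A + Δ_eff • B) = 2J • A - V • B` because `2J Δ_eff = -V`
  have hΔ : (((2 * (plaquettePairCouplings U).J : ℝ) : ℂ)) * (((plaquettePairCouplings U).ΔEff : ℝ) : ℂ) =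
      -(((plaquettePairCouplings U).V : ℝ) : ℂ) := by
    rw [← Complex.ofReal_mul, ← Complex.ofReal_neg, plaquettePairCouplings_ΔEff]
    congr 1
    field_simp
  rw [smul_add, smul_smul, hΔ, neg_smul, sub_eq_add_neg]

end XXZBond

/-! ### Registered sub-goal stub of stmt-HubbardSuperconductivity-8148 (signature verbatim) -/

/-- Registered sub-goal `dressHalfFilled_kernelXXZBond` (per-bond form of dictionary clause (d)): for `U ∈ [2,4]`,
on any lattice and any bond `x ≠ y`, the matrix element of `2J (SˣSˣ + SʸSʸ) - V SᶻSᶻ` between product configurations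
agreeing off the bond equals minus Kato's two-plaquette kernel at the corresponding hole-pair occupations plus a
diagonal term affine in the bond occupation. [cite: YaoTsaiKivelson2007, eq. (2)] -/
theorem dressHalfFilled_kernelXXZBond : ∀ {U : ℝ}, U ∈ Set.Icc (2 : ℝ) 4 → ∀ {Λ : Type} [Fintype Λ] [DecidableEq Λ] {x y : Λ}, x ≠ y → ∀ σ τ : Literature.MathematicalPhysics.QuantumLattice.TensorIndex Λ 2, (∀ z, z ≠ x → z ≠ y → σ z = τ z) → ((((2 * (Literature.MathematicalPhysics.QuantumLattice.plaquettePairCouplings U).J : ℝ) : ℂ)) • (Literature.MathematicalPhysics.QuantumLattice.spinBond 1 0 x y + Literature.MathematicalPhysics.QuantumLattice.spinBond 1 1 x y) - (((Literature.MathematicalPhysics.QuantumLattice.plaquettePairCouplings U).V : ℝ) : ℂ) • Literature.MathematicalPhysics.QuantumLattice.spinBond 1 2 x y) σ τ = -(Literature.MathematicalPhysics.QuantumLattice.plaquetteKernel U ((σ x).rev, (σ y).rev) ((τ x).rev, (τ y).rev)) + (if σ = τ then ((((Literature.MathematicalPhysics.QuantumLattice.plaquetteKernel U (0, 0) (0,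 0)).re - (Literature.MathematicalPhysics.QuantumLattice.plaquettePairCouplings U).V / 4 + ((Literature.MathematicalPhysics.QuantumLattice.plaquettePairCouplings U).μ + (Literature.MathematicalPhysics.QuantumLattice.plaquettePairCouplings U).V / 2) * ((((σ x).rev : ℕ) : ℝ) + (((σ y).rev : ℕ) : ℝ)) : ℝ) : ℂ)) else 0) :=
  fun hU _ _ _ _ _ hxy σ τ h => spinBond_xxz_apply_eq_plaquetteKernel hU hxy σ τ h

end Summit.HubbardSuperconductivity.HubbardSuperconductivity.Theorems.LevyLogBootstrap

end
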